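import Mathlib
import HarnessLib
import Literature.Analysis.FluidPDE.SelfSimilar
import Literature.Analysis.FluidPDE.TaoRadialChaining

/-!
# Route `PoloidalWindowDoor`, crux `PoloidalWindowRigidity` (K2, stmt-NavierStokesRegularity-19708) — whole-class tool:
# SCALING BOOKKEEPING for the large-scale energy bootstrap (parabolic zooms of the ball energy, transport of a
# bound at time `−1` to all times, the small-radius regime, monotonicity of the levels in the exponent)

Cell ns-regularity-ideate, seat ns-poloidal-K2-p3 gen 3 (stub-worker under the K2 lead; file landed
`--supports stmt-NavierStokesRegularity-19708` as a helper).

The LEVELS of the bootstrap are the scale-invariant bounds `∫_{B̄(0,R)} ‖v(t)‖² ≤ K R^α (−t)^{−(α−1)/2}`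
(`t < 0`, `R > 0`).  This file contains no fluid mechanics:
* `setIntegral_closedBall_norm_sq_zoom` — under the parabolic zoom `(𝒵_c v)(s,y) = c v(c²s, cy)` (`c > 0`):
  `∫_{B̄_R} ‖𝒵_c v(s)‖² = c⁻¹ ∫_{B̄_{cR}} ‖v(c²s)‖²`;
* `level_of_level_at_neg_one` — TRANSPORT: if a zoom-invariant property `P` of fields implies the bound
  `∫_{B̄_R}‖w(−1)‖² ≤ K R^α` for all `R ≥ 1`, then every `v` with `P v` obeys the level-`α` bound at every `t < 0`
  and every `R ≥ √(−t)` (zoom by `c = √(−t)`);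
* `setIntegral_closedBall_norm_sq_le_of_small` — the SMALL-RADIUS regime `R ≤ √(−t)` is free from the Type-I rate:
  `∫_{B̄_R}‖v(t)‖² ≤ C²|B̄₁| R^α (−t)^{−(α−1)/2}` for every `α ≤ 3`;
* `level_mono` — for `R ≥ √(−t)` the level bound is monotone in `α`.

WHAT THIS IS NOT: not a claim about Navier–Stokes regularity — change of variables and power bookkeeping (bears_on
LADDER-NS N0 via crux K2 = stmt-19708; whole-class tool).
-/

noncomputable section

-- the summit and its single sub-problem share the name (CONVENTIONS §1), as in every Theorems file
set_option linter.dupNamespace false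

namespace Summit.NavierStokesRegularity.NavierStokesRegularity.Theorems.PoloidalWindowDoorPoloidalWindowRigidityLargeScaleEnergyBootstrapScaling

open MeasureTheory Set Function Filter Topology Metric
open scoped RealInnerProductSpace Pointwise
open Literature.Analysis Literature.Analysis.FluidPDE

/-! ### The ball energy under a parabolic zoom -/

/-- **Zoom of the ball energy**: `∫_{B̄(0,R)} ‖c v(c²s, c x)‖² dx = c⁻¹ ∫_{B̄(0,cR)} ‖v(c²s, y)‖² dy` for `c > 0`,
`R ≥ 0` (substitution `y = cx` in `ℝ³`). [folklore] -/
theorem setIntegral_closedBall_norm_sq_zoom (v : ℝ → EuclideanSpace ℝ (Fin 3) → EuclideanSpace ℝ (Fin 3))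
    {c : ℝ} (hc : 0 < c) (s : ℝ) {R : ℝ} (hR : 0 ≤ R) :
    ∫ x in closedBall (0 : EuclideanSpace ℝ (Fin 3)) R, ‖c • v (c ^ 2 * s) (c • x)‖ ^ 2 =
      c⁻¹ * ∫ y in closedBall (0 : EuclideanSpace ℝ (Fin 3)) (c * R), ‖v (c ^ 2 * s) y‖ ^ 2 := by
  have h1 : ∀ x : EuclideanSpace ℝ (Fin 3), ‖c • v (c ^ 2 * s) (c • x)‖ ^ 2 = c ^ 2 * ‖v (c ^ 2 * s) (c • x)‖ ^ 2 := by
    intro x; rw [norm_smul, Real.norm_of_nonneg hc.le, mul_pow]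
  simp_rw [h1]
  rw [integral_const_mul]
  have h2 := Measure.setIntegral_comp_smul_of_pos volume (fun y => ‖v (c ^ 2 * s) y‖ ^ 2)
    (closedBall (0 : EuclideanSpace ℝ (Fin 3)) R) hc
  rw [smul_closedBall c (0 : EuclideanSpace ℝ (Fin 3)) hR, smul_zero, Real.norm_of_nonneg hc.le,
    finrank_euclideanSpace_fin, smul_eq_mul] at h2
  rw [h2, ← mul_assoc]
  congr 1
  field_simp

/-! ### Transport of a bound at time `−1` to all times -/

/-- **TRANSPORT.**  Let `P` be a property of fields invariant under the parabolic zooms `v ↦ c v(c²·, c·)`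
(`c > 0`), and suppose every `w` with `P w` satisfies `∫_{B̄(0,R)}‖w(−1)‖² ≤ K R^α` for all `R ≥ 1`.  Then every
`v` with `P v` satisfies `∫_{B̄(0,R)}‖v(t)‖² ≤ K R^α (−t)^{−(α−1)/2}` for all `t < 0`, `R ≥ √(−t)`. -/
theorem level_of_level_at_neg_one {P : (ℝ → EuclideanSpace ℝ (Fin 3) → EuclideanSpace ℝ (Fin 3)) → Prop}
    (hP : ∀ v : ℝ → EuclideanSpace ℝ (Fin 3) → EuclideanSpace ℝ (Fin 3), P v → ∀ c : ℝ, 0 < c →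
      P (fun s y => c • v (c ^ 2 * s) (c • y)))
    {K α : ℝ} (H1 : ∀ w : ℝ → EuclideanSpace ℝ (Fin 3) → EuclideanSpace ℝ (Fin 3), P w → ∀ R : ℝ, 1 ≤ R →
      ∫ x in closedBall (0 : EuclideanSpace ℝ (Fin 3)) R, ‖w (-1) x‖ ^ 2 ≤ K * R ^ α)
    {v : ℝ → EuclideanSpace ℝ (Fin 3) → EuclideanSpace ℝ (Fin 3)} (hv : P v) {t : ℝ} (ht : t < 0) {R : ℝ}
    (hR : Real.sqrt (-t) ≤ R) :
    ∫ x in closedBall (0 : EuclideanSpace ℝ (Fin 3)) R, ‖v t x‖ ^ 2 ≤ K * R ^ α * (-t) ^ (-((α - 1) / 2)) := by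
  have ht0 : 0 < -t := neg_pos.2 ht
  set c : ℝ := Real.sqrt (-t) with hcdef
  have hc : 0 < c := Real.sqrt_pos.2 ht0
  have hc2 : c ^ 2 = -t := Real.sq_sqrt ht0.le
  have hR0 : 0 < R := lt_of_lt_of_le hc hR
  have hRc : 1 ≤ R / c := by rwa [le_div_iff₀ hc, one_mul]
  have hw : P (fun s y => c • v (c ^ 2 * s) (c • y)) := hP v hv c hc
  have h := H1 _ hw (R / c) hRc
  rw [setIntegral_closedBall_norm_sq_zoom v hc (-1) (by positivity), mul_div_cancel₀ _ hc.ne',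
    show c ^ 2 * (-1 : ℝ) = t by rw [hc2]; ring] at h
  -- `c⁻¹ I ≤ K (R/c)^α` ⇒ `I ≤ K R^α c^{1−α}`
  have hI : ∫ x in closedBall (0 : EuclideanSpace ℝ (Fin 3)) R, ‖v t x‖ ^ 2 ≤ c * (K * (R / c) ^ α) := by
    have := mul_le_mul_of_nonneg_left h hc.le
    rwa [← mul_assoc, mul_inv_cancel₀ hc.ne', one_mul] at this
  refine hI.trans (le_of_eq ?_)
  rw [Real.div_rpow hR0.le hc.le, hcdef, Real.sqrt_eq_rpow, ← Real.rpow_mul ht0.le]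
  have hpos : 0 < (-t) ^ (1 / (2 : ℝ) * α) := Real.rpow_pos_of_pos ht0 _
  have e1 : (-t) ^ (-((α - 1) / 2)) = (-t) ^ (1 / (2 : ℝ)) / (-t) ^ (1 / (2 : ℝ) * α) := by
    rw [← Real.rpow_sub ht0]; congr 1; ring
  rw [e1]
  field_simp

/-! ### The small-radius regime and monotonicity in the exponent -/

/-- **Small radii are free.**  If `‖v(t,x)‖ ≤ C/√(−t)` then for `0 < R ≤ √(−t)` and every `α ≤ 3`:
`∫_{B̄(0,R)} ‖v(t)‖² ≤ C²|B̄(0,1)| · R^α (−t)^{−(α−1)/2}` (`R³/(−t) = R^α·R^{3−α}/(−t) ≤ R^α (−t)^{(1−α)/2}`). -/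
theorem setIntegral_closedBall_norm_sq_le_of_small {C : ℝ} {v : ℝ → EuclideanSpace ℝ (Fin 3) → EuclideanSpace ℝ (Fin 3)}
    (hrate : HasTypeITimeDecay C v) {α : ℝ} (hα : α ≤ 3) {t : ℝ} (ht : t < 0) {R : ℝ} (hR0 : 0 < R)
    (hR : R ≤ Real.sqrt (-t)) :
    ∫ x in closedBall (0 : EuclideanSpace ℝ (Fin 3)) R, ‖v t x‖ ^ 2 ≤
      C ^ 2 * volume.real (closedBall (0 : EuclideanSpace ℝ (Fin 3)) 1) * R ^ α * (-t) ^ (-((α - 1) / 2)) := by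
  have ht0 : 0 < -t := neg_pos.2 ht
  set V₁ : ℝ := volume.real (closedBall (0 : EuclideanSpace ℝ (Fin 3)) 1) with hV₁
  have hV₁0 : 0 ≤ V₁ := measureReal_nonneg
  have hC0 : 0 ≤ C := by
    have h := hrate t ht 0
    exact (div_nonneg_iff.1 ((norm_nonneg _).trans h)).elim (fun h => h.1)
      (fun h => by have := Real.sqrt_pos.2 ht0; linarith [h.2])
  -- pointwise bound and integration over the ball
  have hbd : ∀ x ∈ closedBall (0 : EuclideanSpace ℝ (Fin 3)) R, ‖‖v t x‖ ^ 2‖ ≤ C ^ 2 / (-t) := by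
    intro x _
    rw [Real.norm_eq_abs, abs_of_nonneg (sq_nonneg _)]
    calc ‖v t x‖ ^ 2 ≤ (C / Real.sqrt (-t)) ^ 2 := pow_le_pow_left₀ (norm_nonneg _) (hrate t ht x) 2
      _ = C ^ 2 / (-t) := by rw [div_pow, Real.sq_sqrt ht0.le]
  have hfin : volume (closedBall (0 : EuclideanSpace ℝ (Fin 3)) R) < ⊤ := measure_closedBall_lt_top
  have h1 := norm_setIntegral_le_of_norm_le_const hfin hbd
  rw [Real.norm_eq_abs] at h1
  have h2 := le_of_abs_le h1
  have hvol : volume.real (closedBall (0 : EuclideanSpace ℝ (Fin 3)) R) = R ^ 3 * V₁ := by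
    rw [hV₁, measureReal_def, measureReal_def, Measure.addHaar_closedBall' volume (0 : EuclideanSpace ℝ (Fin 3)) hR0.le,
      ENNReal.toReal_mul, ENNReal.toReal_ofReal (by positivity), finrank_euclideanSpace_fin]
  rw [hvol] at h2
  refine h2.trans ?_
  -- `C²/(−t) · R³ V₁ ≤ C² V₁ R^α (−t)^{−(α−1)/2}`
  have hR3 : (R ^ 3 : ℝ) = R ^ α * R ^ (3 - α) := by
    rw [← Real.rpow_add hR0, show α + (3 - α) = ((3 : ℕ) : ℝ) by push_cast; ring, Real.rpow_natCast]
  have hRt : R ^ (3 - α) ≤ (-t) ^ ((3 - α) / 2) := by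
    calc R ^ (3 - α) ≤ (Real.sqrt (-t)) ^ (3 - α) := Real.rpow_le_rpow hR0.le hR (by linarith)
      _ = (-t) ^ ((3 - α) / 2) := by rw [Real.sqrt_eq_rpow, ← Real.rpow_mul ht0.le]; ring_nf
  have hexp : (-t) ^ ((3 - α) / 2) / (-t) = (-t) ^ (-((α - 1) / 2)) := by
    rw [show (-((α - 1) / 2)) = (3 - α) / 2 - 1 by ring, Real.rpow_sub ht0, Real.rpow_one]
  calc C ^ 2 / (-t) * (R ^ 3 * V₁) = C ^ 2 * V₁ * R ^ α * (R ^ (3 - α) / (-t)) := by rw [hR3]; ring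
    _ ≤ C ^ 2 * V₁ * R ^ α * ((-t) ^ ((3 - α) / 2) / (-t)) := by
        gcongr
    _ = C ^ 2 * V₁ * R ^ α * (-t) ^ (-((α - 1) / 2)) := by rw [hexp]

/-- **Monotonicity of the levels in the exponent** (large radii): for `√(−t) ≤ R`, `K ≥ 0` and `a ≤ b`,
`K R^a (−t)^{−(a−1)/2} ≤ K R^b (−t)^{−(b−1)/2}` (both equal `K R (R²/(−t))^{(·−1)/2}`, and `R²/(−t) ≥ 1`). -/
theorem level_mono {K a b t R : ℝ} (hK : 0 ≤ K) (hab : a ≤ b) (ht : t < 0) (hR : Real.sqrt (-t) ≤ R) :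
    K * R ^ a * (-t) ^ (-((a - 1) / 2)) ≤ K * R ^ b * (-t) ^ (-((b - 1) / 2)) := by
  have ht0 : 0 < -t := neg_pos.2 ht
  have hc : 0 < Real.sqrt (-t) := Real.sqrt_pos.2 ht0
  have hR0 : 0 < R := lt_of_lt_of_le hc hR
  have hR2 : -t ≤ R ^ 2 := by
    have := pow_le_pow_left₀ hc.le hR 2
    rwa [Real.sq_sqrt ht0.le] at this
  have hq : 1 ≤ R ^ 2 / (-t) := by rwa [le_div_iff₀ ht0, one_mul]
  -- rewrite both sides as `K R (R²/(−t))^{(·−1)/2}`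
  have e : ∀ d : ℝ, R ^ d * (-t) ^ (-((d - 1) / 2)) = R * (R ^ 2 / (-t)) ^ ((d - 1) / 2) := by
    intro d
    rw [Real.div_rpow (pow_nonneg hR0.le 2) ht0.le, show (R ^ 2 : ℝ) = R ^ (2 : ℝ) by norm_cast,
      ← Real.rpow_mul hR0.le, Real.rpow_neg ht0.le, div_eq_mul_inv]
    have : R ^ d = R * R ^ (2 * ((d - 1) / 2)) := by
      rw [show 2 * ((d - 1) / 2) = d - 1 by ring, Real.rpow_sub hR0, Real.rpow_one]; field_simp
    rw [this]; ring
  rw [mul_assoc, mul_assoc, e a, e b]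
  refine mul_le_mul_of_nonneg_left (mul_le_mul_of_nonneg_left ?_ hR0.le) hK
  exact Real.rpow_le_rpow_of_exponent_le hq (by linarith)

end Summit.NavierStokesRegularity.NavierStokesRegularity.Theorems.PoloidalWindowDoorPoloidalWindowRigidityLargeScaleEnergyBootstrapScaling

end
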